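import Summits.KontsevichZagierPeriods.Zeta5Search.LaiSweepShard

/-!
# `κ₃` sweep certificate — shard file 045 of 127 (shards 315–321 of 889)

HONEST FRAMING. Systematic search; no irrationality claim unless certified. This file only checks,
by `decide +kernel`, shards 315–321 of the order-cell sweep of the `κ₃` point `(74, 2180, 444; δ74)`
(engine `LaiSweepEngine`, soundness `LaiSweepJump/Free/Eval/Shard/Kappa3`; a shard is `⟨regime, n,
p, q, p', q', Lo, Up⟩`: `n` cells from `p/q` to `p'/q'` with integer rate sums in `[Lo, Up]`, `K =
128`, `D = 2^40`). It draws NO conclusion: only the capstone `LaiKappa3SweepCert`, which needs all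
127 shard files, does. Kernel cost of this file ≈ 560 cells × 0.3 s.
-/

namespace Summit.KontsevichZagierPeriods.Zeta5Search.Sweep

set_option maxHeartbeats 100000000 in
/-- Shard 315: 80 cells of regime B from `37/133` to `83/297`.
[cite: Lai2024BallRivoal, §4 Lemma 4.3] -/
theorem shard315 :
    Shard.check 128 (2^40)
      ⟨true, 80, 37, 133, 83, 297, 24310084075176, 25782292462260⟩ = true := by
  decide +kernel

set_option maxHeartbeats 100000000 in
/-- Shard 316: 80 cells of regime B from `83/297` to `105/374`.
[cite: Lai2024BallRivoal, §4 Lemma 4.3] -/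
theorem shard316 :
    Shard.check 128 (2^40)
      ⟨true, 80, 83, 297, 105, 374, 24616578603734, 26123122541996⟩ = true := by
  decide +kernel

set_option maxHeartbeats 100000000 in
/-- Shard 317: 80 cells of regime B from `105/374` to `75/266`.
[cite: Lai2024BallRivoal, §4 Lemma 4.3] -/
theorem shard317 :
    Shard.check 128 (2^40)
      ⟨true, 80, 105, 374, 75, 266, 22992131450850, 24413161346619⟩ = true := by
  decide +kernel

set_option maxHeartbeats 100000000 in
/-- Shard 318: 80 cells of regime B from `75/266` to `49/173`.
[cite: Lai2024BallRivoal, §4 Lemma 4.3] -/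
theorem shard318 :
    Shard.check 128 (2^40)
      ⟨true, 80, 75, 266, 49, 173, 24321368960196, 25839856320748⟩ = true := by
  decide +kernel

set_option maxHeartbeats 100000000 in
/-- Shard 319: 80 cells of regime B from `49/173` to `33/116`.
[cite: Lai2024BallRivoal, §4 Lemma 4.3] -/
theorem shard319 :
    Shard.check 128 (2^40)
      ⟨true, 80, 49, 173, 33, 116, 23559854321637, 25045393828718⟩ = true := by
  decide +kernel

set_option maxHeartbeats 100000000 in
/-- Shard 320: 80 cells of regime B from `33/116` to `127/444`.
[cite: Lai2024BallRivoal, §4 Lemma 4.3] -/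
theorem shard320 :
    Shard.check 128 (2^40)
      ⟨true, 80, 33, 116, 127, 444, 29174177194914, 31039740198673⟩ = true := by
  decide +kernel

set_option maxHeartbeats 100000000 in
/-- Shard 321: 80 cells of regime B from `127/444` to `1379/4804`.
[cite: Lai2024BallRivoal, §4 Lemma 4.3] -/
theorem shard321 :
    Shard.check 128 (2^40)
      ⟨true, 80, 127, 444, 1379, 4804, 19070584551082, 20298660158092⟩ = true := by
  decide +kernel

/-- The checked shards of this file, in order. [folklore] -/
def shards045 : List (CheckedShard 128 (2^40)) :=
  [⟨_, shard315⟩, ⟨_, shard316⟩, ⟨_, shard317⟩, ⟨_, shard318⟩, ⟨_, shard319⟩,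
    ⟨_, shard320⟩, ⟨_, shard321⟩]

end Summit.KontsevichZagierPeriods.Zeta5Search.Sweep
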